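import Mathlib.Analysis.Normed.Lp.lpSpace
import Summits.QuantumFields.BalabanUV.T4Continuum.Support.NE9ChannelRealLinear

/-!
# NE9SliceSpaceOfRecord — the COMPLEX BANACH-TYPE SLICE SPACE 𝔜 of route R4's future-influence coordinates, built over the END
# of record's admissible class: decay-weighted bounded complex term families whose real and imaginary parts are admissible,
# with the weighted coordinate read-outs `coord U X : 𝔜 →L[ℂ] ℂ` (‖·‖ ≤ e^{−κd(X)}) and the embedding of real admissible
# families of finite size (route R4, INTERFACE REQUEST NE9 (R4-4): the owner's docking of K2♭'s binders (B2)∕(B4), part 1)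

Cell `pub-balaban`, T4-DAG §2 node U3 ∕ §6 NE9; BINDER row NE9 OWNER lineage `b2b-balaban-t4-ne9-p1`, generation 60; CRUX PROVER
NE9 under the coordinator ruling «YM REDIRECT» e34b3e0c (2); route R4 «fading by Earle–Hamilton» of `t4/ROUTES-NE9.md` v4 §L1.0
(EH1 state space «𝔜 := decay-normed scale-slices of terms, complex values»); K2♭ instance (leaf-04 g45
`NE9FutureInfluenceInstance` 56445b4012700b9d: `Φ : ℕ → ℝ → Pot → 𝔜`, `Rd m j s : 𝔜 →L[ℂ] Pot`, `coord U X : 𝔜 →L[ℂ] ℂ`).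

HONEST FRAMING (T4-DAG PAGE 1).  Rung (B)+1 of the FINITE-VOLUME T⁴ programme — NOT infinite volume, NOT a mass gap, NOT the
Clay problem.  NE9 (`T4OutputRate.NE9` ∧ `FadingMemory`) is a cell NEW ESTIMATE, NOT PRINTED in [I] = [Balaban1987RG1]
(CMP **109**), [II] = [Balaban1988RG2Cluster] (CMP **116**), and NOT PROVED for Bałaban's E^{(j)} («NE9 ⇐ the named binders»;
row WALLED ON A MODEL O-NE9-1; spine PROVED 0∕9).  HONEST DEPENDENCY (cell line, verbatim): continuum YM on T⁴ ⇐ BetaPertH ∧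
nine spine estimates (0/9 proved); BetaPertH ⇐ (D1) ∧ (D4) ∧ CAP+tail; G-an2-4 gates asym, D1 and NE2/3/4.  `FlowStep.BetaPertH`,
(B), (B^μ) do not occur.  Generic functional analysis on Mathlib's `lp … ∞` over the BINDER SHAPES of
`T4HistoryLipschitzRecursion`; data definitions only (no `def … : Prop`), no estimate of any object of the series; [I]∕[II] quoted
for TYPES only (ABSOLUTE RULE).  0 sorry.

WHY.  Route R4's END at the complex-Banach level (K2♭) is stated over ONE complex normed space 𝔜 of «slices» with (B2) ℂ-linear
readings `𝔜 →L[ℂ] Pot` and (B4) a coordinate read-out `E g U X = Re (coord U X (emb (scale X) g).1)`, `‖coord U X‖ ≤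
cY·e^{−κd(X)}`.  The END of record's terms are REAL families `H : Bg → C.Dom → ℝ` of an admissible class `Adm` (closed under
differences — `AdmissibleTerms` —, restrictions — `AdmRestrict` — and, by inspection of every class of record, real scalars),
sized by `|H U X| ≤ e^{−κd(X)}·N`.  THIS FILE builds the 𝔜 on which the record's channel complexifies (sibling part 2,
`NE9ChannelReadingOfRecord`, via `NE9ChannelRealLinear`): the ambient space is `lp (fun _ : Bg × C.Dom => ℂ) ∞` in WEIGHTED
coordinates `G (U, X) ↔ e^{κd(X)}·F U X` (so the `lp` norm IS the decay-weighted sup norm of EH1), the real∕imaginary families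
`reF κ G U X := e^{−κd(X)}·Re G(U,X)`, `imF`, and 𝔜 = `sliceSub κ Adm …` := the ℂ-SUBMODULE of ambient elements whose `reF` and
`imF` lie in `Adm` (a submodule because `Adm` is an ℝ-subspace: `(a+bi)•G` has parts `a•reF G − b•imF G`, `a•imF G + b•reF G`).
* §1 `reF`, `imF`; `reF_add ∕ imF_add ∕ reF_smul ∕ imF_smul` (complex scalars), `abs_reF_le ∕ abs_imF_le` (`≤ e^{−κd(X)}·‖G‖`),
  `norm_mk_reF_imF` (the complex modulus of the pair is `e^{−κd(X)}·‖G (U,X)‖ ≤ e^{−κd(X)}·‖G‖`).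
* §2 **`sliceSub κ Adm hsub hsmul hne : Submodule ℂ (lp (fun _ : Bg × C.Dom => ℂ) ∞)`**, `mem_sliceSub`.
* §3 `evalCLM p` (coordinate evaluation of `lp … ∞`, norm ≤ 1), **`coord κ U X : lp … →L[ℂ] ℂ`** = `e^{−κd(X)} • evalCLM (U,X)`,
  `coord_apply`, **`norm_coord_le`** (`‖coord κ U X‖ ≤ e^{−κd(X)}` — (B4)'s `hcoord` with `cY = 1` before the `τ₀`-scaling),
  `coord_re_eq_reF` (`Re (coord κ U X G) = reF κ G U X`); restriction to the submodule `coordSub`.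
* §4 **`embR κ H`** — the ambient element of a real family with a finite decay-weighted size (junk `0` otherwise; the branches never
  meet under the size hypothesis), `embR_apply`, `reF_embR` (= `H`), `imF_embR` (= `0`), `norm_embR_le` (`≤ N`),
  **`embR_mem_sliceSub`** (for `H ∈ Adm`), `coord_embR_re` (`Re (coord κ U X (embR κ H)) = H U X` — (B4) at actual states).
DISGUISE TEST: a function space and its coordinates; no activity, no species, no channel, no estimate; not NE9.

References (TYPES only): [Balaban1988RG2Cluster] T. Bałaban, CMP **116** (1988) 1–22, (1.18)-type decay norms p. 9 (1.36), p. 7;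
[Balaban1987RG1] T. Bałaban, CMP **109** (1987) 249–301, (1.18) p. 263 (the norm `sup e^{κd_j(X)}|·|`).  Summits-side NEW work
(LEAN PLACEMENT RULE); imports Mathlib `lp` and this lineage's `NE9ChannelRealLinear` (closure lemmas) BY NAME; modifies nothing;
0 sorry.  Value = the state-space letter 𝔜 of route R4 typed over the record's class, NOT summit progress.
-/

noncomputable section

namespace Summit.QuantumFields.BalabanUV.T4Continuum.NE9SliceSpaceOfRecord

open scoped ENNReal
open Literature.MathematicalPhysics.QuantumFieldTheory.Balaban1983to89
open Literature.MathematicalPhysics.QuantumFieldTheory.Balaban1983to89.T4OutputRate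
open Summit.QuantumFields.BalabanUV.T4Continuum.NE9ChannelRealLinear

variable {C : Carriers} {Bg : Type}

/-! ## §1 Real and imaginary families of an ambient element (un-weighting the coordinates) -/

/-- [folklore] DATA: the REAL family of an ambient element `G : lp (fun _ : Bg × C.Dom => ℂ) ∞` read in decay-weighted
coordinates: `reF κ G U X := e^{−κd(X)}·Re G(U,X)`. [cite: Balaban1987RG1, (1.18) p.263] -/
def reF (κ : ℝ) (G : lp (fun _ : Bg × C.Dom => ℂ) ∞) : Bg → C.Dom → ℝ :=
  fun U X => Real.exp (-(κ * C.d X)) * (G (U, X)).re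

/-- [folklore] DATA: the IMAGINARY family `imF κ G U X := e^{−κd(X)}·Im G(U,X)`. [cite: Balaban1987RG1, (1.18) p.263] -/
def imF (κ : ℝ) (G : lp (fun _ : Bg × C.Dom => ℂ) ∞) : Bg → C.Dom → ℝ :=
  fun U X => Real.exp (-(κ * C.d X)) * (G (U, X)).im

/-- [folklore] `reF` unfolds. -/
@[simp] theorem reF_apply (κ : ℝ) (G : lp (fun _ : Bg × C.Dom => ℂ) ∞) (U : Bg) (X : C.Dom) :
    reF κ G U X = Real.exp (-(κ * C.d X)) * (G (U, X)).re := rfl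

/-- [folklore] `imF` unfolds. -/
@[simp] theorem imF_apply (κ : ℝ) (G : lp (fun _ : Bg × C.Dom => ℂ) ∞) (U : Bg) (X : C.Dom) :
    imF κ G U X = Real.exp (-(κ * C.d X)) * (G (U, X)).im := rfl

/-- [folklore] `reF` is additive. -/
theorem reF_add (κ : ℝ) (G G' : lp (fun _ : Bg × C.Dom => ℂ) ∞) : reF κ (G + G') = reF κ G + reF κ G' := by
  funext U X
  simp only [reF_apply, Pi.add_apply, lp.coeFn_add, Complex.add_re, mul_add]

/-- [folklore] `imF` is additive. -/
theorem imF_add (κ : ℝ) (G G' : lp (fun _ : Bg × C.Dom => ℂ) ∞) : imF κ (G + G') = imF κ G + imF κ G' := by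
  funext U X
  simp only [imF_apply, Pi.add_apply, lp.coeFn_add, Complex.add_im, mul_add]

/-- [folklore] `reF` of a complex multiple: `reF (z•G) = z.re•reF G − z.im•imF G`. -/
theorem reF_smul (κ : ℝ) (z : ℂ) (G : lp (fun _ : Bg × C.Dom => ℂ) ∞) :
    reF κ (z • G) = z.re • reF κ G - z.im • imF κ G := by
  funext U X
  simp only [reF_apply, imF_apply, Pi.sub_apply, Pi.smul_apply, lp.coeFn_smul, smul_eq_mul, Complex.mul_re]
  ring

/-- [folklore] `imF` of a complex multiple: `imF (z•G) = z.re•imF G + z.im•reF G`. -/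
theorem imF_smul (κ : ℝ) (z : ℂ) (G : lp (fun _ : Bg × C.Dom => ℂ) ∞) :
    imF κ (z • G) = z.re • imF κ G + z.im • reF κ G := by
  funext U X
  simp only [reF_apply, imF_apply, Pi.add_apply, Pi.smul_apply, lp.coeFn_smul, smul_eq_mul, Complex.mul_im]
  ring

/-- [folklore] `reF 0 = 0`. -/
theorem reF_zero (κ : ℝ) : reF κ (0 : lp (fun _ : Bg × C.Dom => ℂ) ∞) = 0 := by
  funext U X
  simp only [reF_apply, lp.coeFn_zero, Pi.zero_apply, Complex.zero_re, mul_zero]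

/-- [folklore] `imF 0 = 0`. -/
theorem imF_zero (κ : ℝ) : imF κ (0 : lp (fun _ : Bg × C.Dom => ℂ) ∞) = 0 := by
  funext U X
  simp only [imF_apply, lp.coeFn_zero, Pi.zero_apply, Complex.zero_im, mul_zero]

/-- [folklore] THE COMPLEX MODULUS OF THE PAIR at `(U, X)` is the un-weighted coordinate: `‖(reF G U X, imF G U X)‖_ℂ =
e^{−κd(X)}·‖G (U, X)‖`. -/
theorem norm_mk_reF_imF (κ : ℝ) (G : lp (fun _ : Bg × C.Dom => ℂ) ∞) (U : Bg) (X : C.Dom) :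
    ‖(⟨reF κ G U X, imF κ G U X⟩ : ℂ)‖ = Real.exp (-(κ * C.d X)) * ‖G (U, X)‖ := by
  have h : (⟨reF κ G U X, imF κ G U X⟩ : ℂ) = (Real.exp (-(κ * C.d X)) : ℂ) * G (U, X) := by
    apply Complex.ext
    · simp only [reF_apply, Complex.mul_re, Complex.ofReal_re, Complex.ofReal_im, zero_mul, sub_zero]
    · simp only [imF_apply, Complex.mul_im, Complex.ofReal_re, Complex.ofReal_im, zero_mul, add_zero]
  rw [h, norm_mul, Complex.norm_real, Real.norm_of_nonneg (Real.exp_pos _).le]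

/-- [folklore] **THE SIZE PROFILE OF AN AMBIENT ELEMENT**: `‖(reF G U X, imF G U X)‖_ℂ ≤ e^{−κd(X)}·‖G‖` — every element of the
slice space carries the decay-weighted profile `N := ‖G‖` at EVERY creation step. [cite: Balaban1987RG1, (1.18) p.263] -/
theorem norm_mk_reF_imF_le (κ : ℝ) (G : lp (fun _ : Bg × C.Dom => ℂ) ∞) (U : Bg) (X : C.Dom) :
    ‖(⟨reF κ G U X, imF κ G U X⟩ : ℂ)‖ ≤ Real.exp (-(κ * C.d X)) * ‖G‖ := by
  rw [norm_mk_reF_imF]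
  exact mul_le_mul_of_nonneg_left (lp.norm_apply_le_norm ENNReal.top_ne_zero G (U, X)) (Real.exp_pos _).le

/-- [folklore] `|reF κ G U X| ≤ e^{−κd(X)}·‖G‖`. -/
theorem abs_reF_le (κ : ℝ) (G : lp (fun _ : Bg × C.Dom => ℂ) ∞) (U : Bg) (X : C.Dom) :
    |reF κ G U X| ≤ Real.exp (-(κ * C.d X)) * ‖G‖ :=
  (abs_re_im_le_of_norm_mk_le (norm_mk_reF_imF_le κ G U X)).1

/-- [folklore] `|imF κ G U X| ≤ e^{−κd(X)}·‖G‖`. -/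
theorem abs_imF_le (κ : ℝ) (G : lp (fun _ : Bg × C.Dom => ℂ) ∞) (U : Bg) (X : C.Dom) :
    |imF κ G U X| ≤ Real.exp (-(κ * C.d X)) * ‖G‖ :=
  (abs_re_im_le_of_norm_mk_le (norm_mk_reF_imF_le κ G U X)).2

/-! ## §2 The slice space of record: the ℂ-submodule of ambient elements with admissible real and imaginary families -/

/-- **THE SLICE SPACE OF RECORD** (route R4 EH1's 𝔜 over the END of record's admissible class): the ℂ-submodule of
`lp (fun _ : Bg × C.Dom => ℂ) ∞` of the elements whose real and imaginary families lie in `Adm` — a submodule because `Adm` is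
closed under differences (`AdmissibleTerms`, [II] p. 7) and real scalars (by inspection of every class of record) and is
nonempty.  Its norm is the decay-weighted sup norm `sup_{U,X} e^{κd(X)}·|F U X|` of [I] (1.18) p. 263 ∕ [II] (1.36) p. 9, for
complex values. [cite: Balaban1987RG1, (1.18) p.263; Balaban1988RG2Cluster, p.7] -/
def sliceSub (κ : ℝ) (Adm : Set (Bg → C.Dom → ℝ)) (hsub : ∀ H₁ ∈ Adm, ∀ H₂ ∈ Adm, H₁ - H₂ ∈ Adm)
    (hsmul : ∀ (c : ℝ), ∀ H ∈ Adm, c • H ∈ Adm) (hne : Adm.Nonempty) :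
    Submodule ℂ (lp (fun _ : Bg × C.Dom => ℂ) ∞) where
  carrier := {G | reF κ G ∈ Adm ∧ imF κ G ∈ Adm}
  zero_mem' := by
    obtain ⟨H, hH⟩ := hne
    refine ⟨?_, ?_⟩
    · rw [reF_zero]; exact zero_mem_of_closed hsub hH
    · rw [imF_zero]; exact zero_mem_of_closed hsub hH
  add_mem' := by
    intro G G' hG hG'
    refine ⟨?_, ?_⟩
    · rw [reF_add]; exact add_mem_of_closed hsub hsmul hG.1 hG'.1
    · rw [imF_add]; exact add_mem_of_closed hsub hsmul hG.2 hG'.2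
  smul_mem' := by
    intro z G hG
    refine ⟨?_, ?_⟩
    · rw [reF_smul]; exact hsub _ (hsmul _ _ hG.1) _ (hsmul _ _ hG.2)
    · rw [imF_smul]; exact add_mem_of_closed hsub hsmul (hsmul _ _ hG.2) (hsmul _ _ hG.1)

/-- [folklore] Membership in the slice space of record, unfolded. -/
theorem mem_sliceSub {κ : ℝ} {Adm : Set (Bg → C.Dom → ℝ)} {hsub : ∀ H₁ ∈ Adm, ∀ H₂ ∈ Adm, H₁ - H₂ ∈ Adm}
    {hsmul : ∀ (c : ℝ), ∀ H ∈ Adm, c • H ∈ Adm} {hne : Adm.Nonempty} {G : lp (fun _ : Bg × C.Dom => ℂ) ∞} :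
    G ∈ sliceSub κ Adm hsub hsmul hne ↔ reF κ G ∈ Adm ∧ imF κ G ∈ Adm := Iff.rfl

/-! ## §3 The weighted coordinate read-outs -/

/-- [folklore] DATA: coordinate evaluation of `lp … ∞` at `p`, as a bounded ℂ-linear functional. -/
def evalCLM (p : Bg × C.Dom) : lp (fun _ : Bg × C.Dom => ℂ) ∞ →L[ℂ] ℂ :=
  LinearMap.mkContinuous
    { toFun := fun G => G p
      map_add' := fun G G' => by simp only [lp.coeFn_add, Pi.add_apply]
      map_smul' := fun z G => by simp only [lp.coeFn_smul, Pi.smul_apply, RingHom.id_apply] }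
    1 fun G => by
      simp only [LinearMap.coe_mk, AddHom.coe_mk, one_mul]
      exact lp.norm_apply_le_norm ENNReal.top_ne_zero G p

/-- [folklore] `evalCLM p G = G p`. -/
@[simp] theorem evalCLM_apply (p : Bg × C.Dom) (G : lp (fun _ : Bg × C.Dom => ℂ) ∞) : evalCLM p G = G p := rfl

/-- [folklore] `‖evalCLM p‖ ≤ 1`. -/
theorem norm_evalCLM_le (p : Bg × C.Dom) : ‖(evalCLM p : lp (fun _ : Bg × C.Dom => ℂ) ∞ →L[ℂ] ℂ)‖ ≤ 1 :=
  LinearMap.mkContinuous_norm_le _ zero_le_one _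

/-- **THE WEIGHTED COORDINATE READ-OUT** `coord κ U X := e^{−κd(X)} • evalCLM (U, X)` — K2♭'s (B4) letter `coord U X : 𝔜 →L[ℂ] ℂ`
on the ambient space (restrict along the submodule inclusion for 𝔜). [cite: Balaban1987RG1, (1.18) p.263] -/
def coord (κ : ℝ) (U : Bg) (X : C.Dom) : lp (fun _ : Bg × C.Dom => ℂ) ∞ →L[ℂ] ℂ :=
  (Real.exp (-(κ * C.d X)) : ℂ) • evalCLM (U, X)

/-- [folklore] `coord κ U X G = e^{−κd(X)}·G (U, X)`. -/
theorem coord_apply (κ : ℝ) (U : Bg) (X : C.Dom) (G : lp (fun _ : Bg × C.Dom => ℂ) ∞) :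
    coord κ U X G = (Real.exp (-(κ * C.d X)) : ℂ) * G (U, X) := rfl

/-- **(B4)'s `hcoord` WITH `cY = 1`**: `‖coord κ U X‖ ≤ e^{−κd(X)}`. [folklore] -/
theorem norm_coord_le (κ : ℝ) (U : Bg) (X : C.Dom) :
    ‖(coord κ U X : lp (fun _ : Bg × C.Dom => ℂ) ∞ →L[ℂ] ℂ)‖ ≤ Real.exp (-(κ * C.d X)) := by
  refine ContinuousLinearMap.opNorm_le_bound _ (Real.exp_pos _).le fun G => ?_
  rw [coord_apply, norm_mul, Complex.norm_real, Real.norm_of_nonneg (Real.exp_pos _).le]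
  exact mul_le_mul_of_nonneg_left (lp.norm_apply_le_norm ENNReal.top_ne_zero G (U, X)) (Real.exp_pos _).le

/-- [folklore] The real part of the coordinate read-out is the real family: `Re (coord κ U X G) = reF κ G U X`. -/
theorem coord_re_eq_reF (κ : ℝ) (U : Bg) (X : C.Dom) (G : lp (fun _ : Bg × C.Dom => ℂ) ∞) :
    (coord κ U X G).re = reF κ G U X := by
  rw [coord_apply, reF_apply, Complex.mul_re, Complex.ofReal_re, Complex.ofReal_im, zero_mul, sub_zero]

/-- [folklore] The imaginary part of the coordinate read-out is the imaginary family. -/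
theorem coord_im_eq_imF (κ : ℝ) (U : Bg) (X : C.Dom) (G : lp (fun _ : Bg × C.Dom => ℂ) ∞) :
    (coord κ U X G).im = imF κ G U X := by
  rw [coord_apply, imF_apply, Complex.mul_im, Complex.ofReal_re, Complex.ofReal_im, zero_mul, add_zero]

/-- [folklore] DATA: the coordinate read-out restricted to a submodule `S` (K2♭'s `coord U X : 𝔜 →L[ℂ] ℂ` for `𝔜 := ↥S`), with the
same norm bound. -/
def coordSub (κ : ℝ) (S : Submodule ℂ (lp (fun _ : Bg × C.Dom => ℂ) ∞)) (U : Bg) (X : C.Dom) : S →L[ℂ] ℂ :=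
  (coord κ U X).comp S.subtypeL

/-- [folklore] `coordSub` is `coord` on the inclusion. -/
theorem coordSub_apply (κ : ℝ) (S : Submodule ℂ (lp (fun _ : Bg × C.Dom => ℂ) ∞)) (U : Bg) (X : C.Dom) (G : S) :
    coordSub κ S U X G = coord κ U X (G : lp (fun _ : Bg × C.Dom => ℂ) ∞) := rfl

/-- [folklore] `‖coordSub κ S U X‖ ≤ e^{−κd(X)}`. -/
theorem norm_coordSub_le (κ : ℝ) (S : Submodule ℂ (lp (fun _ : Bg × C.Dom => ℂ) ∞)) (U : Bg) (X : C.Dom) :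
    ‖coordSub κ S U X‖ ≤ Real.exp (-(κ * C.d X)) := by
  refine ContinuousLinearMap.opNorm_le_bound _ (Real.exp_pos _).le fun G => ?_
  rw [coordSub_apply]
  exact ((coord κ U X).le_of_opNorm_le (norm_coord_le κ U X) _).trans
    (mul_le_mul_of_nonneg_left (Submodule.norm_coe G).le (Real.exp_pos _).le)

/-! ## §4 Embedding real families of finite decay-weighted size -/

/-- [folklore] The weighted complex coordinates of a real family: `(U, X) ↦ e^{κd(X)}·H U X`. -/
def wcoord (κ : ℝ) (H : Bg → C.Dom → ℝ) : Bg × C.Dom → ℂ := fun p => ((Real.exp (κ * C.d p.2) * H p.1 p.2 : ℝ) : ℂ)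

/-- [folklore] `wcoord` unfolds. -/
@[simp] theorem wcoord_apply (κ : ℝ) (H : Bg → C.Dom → ℝ) (p : Bg × C.Dom) :
    wcoord κ H p = ((Real.exp (κ * C.d p.2) * H p.1 p.2 : ℝ) : ℂ) := rfl

/-- [folklore] A real family of decay-weighted size `N` has BOUNDED weighted coordinates. -/
theorem memℓp_wcoord_of_bound {κ : ℝ} {H : Bg → C.Dom → ℝ} {N : ℝ}
    (h : ∀ (U : Bg) (X : C.Dom), |H U X| ≤ Real.exp (-(κ * C.d X)) * N) : Memℓp (wcoord κ H) ∞ := by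
  refine memℓp_infty ⟨N, ?_⟩
  rintro _ ⟨p, rfl⟩
  show ‖wcoord κ H p‖ ≤ N
  rw [wcoord_apply, Complex.norm_real, Real.norm_eq_abs, abs_mul, abs_of_pos (Real.exp_pos _)]
  have h1 := mul_le_mul_of_nonneg_left (h p.1 p.2) (Real.exp_pos (κ * C.d p.2)).le
  rwa [← mul_assoc, ← Real.exp_add, add_neg_cancel, Real.exp_zero, one_mul] at h1

open Classical in
/-- **THE EMBEDDING OF A REAL FAMILY** of finite decay-weighted size as an ambient element (weighted coordinates when bounded,
the zero element otherwise — the branches never meet under the size hypothesis of every lemma below). [cite: Balaban1987RG1, (1.18) p.263] -/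
def embR (κ : ℝ) (H : Bg → C.Dom → ℝ) : lp (fun _ : Bg × C.Dom => ℂ) ∞ :=
  if h : Memℓp (wcoord κ H) ∞ then ⟨wcoord κ H, h⟩ else 0

/-- [folklore] On bounded families the embedding has the weighted coordinates. -/
theorem embR_apply_of_bound {κ : ℝ} {H : Bg → C.Dom → ℝ} {N : ℝ}
    (h : ∀ (U : Bg) (X : C.Dom), |H U X| ≤ Real.exp (-(κ * C.d X)) * N) (U : Bg) (X : C.Dom) :
    (embR κ H : Bg × C.Dom → ℂ) (U, X) = ((Real.exp (κ * C.d X) * H U X : ℝ) : ℂ) := by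
  rw [embR, dif_pos (memℓp_wcoord_of_bound h)]
  rfl

/-- **THE REAL FAMILY IS RECOVERED**: `reF κ (embR κ H) = H` for `H` of finite decay-weighted size. [folklore] -/
theorem reF_embR {κ : ℝ} {H : Bg → C.Dom → ℝ} {N : ℝ}
    (h : ∀ (U : Bg) (X : C.Dom), |H U X| ≤ Real.exp (-(κ * C.d X)) * N) : reF κ (embR κ H) = H := by
  funext U X
  rw [reF_apply, embR_apply_of_bound h, Complex.ofReal_re, ← mul_assoc, ← Real.exp_add, neg_add_cancel, Real.exp_zero,
    one_mul]

/-- **NO IMAGINARY PART**: `imF κ (embR κ H) = 0`. [folklore] -/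
theorem imF_embR {κ : ℝ} {H : Bg → C.Dom → ℝ} {N : ℝ}
    (h : ∀ (U : Bg) (X : C.Dom), |H U X| ≤ Real.exp (-(κ * C.d X)) * N) : imF κ (embR κ H) = 0 := by
  funext U X
  rw [imF_apply, embR_apply_of_bound h, Complex.ofReal_im, mul_zero, Pi.zero_apply, Pi.zero_apply]

/-- **THE SIZE IS THE NORM BOUND**: `‖embR κ H‖ ≤ N`. [folklore] -/
theorem norm_embR_le {κ : ℝ} {H : Bg → C.Dom → ℝ} {N : ℝ} (hN : 0 ≤ N)
    (h : ∀ (U : Bg) (X : C.Dom), |H U X| ≤ Real.exp (-(κ * C.d X)) * N) : ‖embR κ H‖ ≤ N := by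
  refine lp.norm_le_of_forall_le hN fun p => ?_
  obtain ⟨U, X⟩ := p
  rw [embR_apply_of_bound h, Complex.norm_real, Real.norm_eq_abs, abs_mul, abs_of_pos (Real.exp_pos _)]
  have h1 := mul_le_mul_of_nonneg_left (h U X) (Real.exp_pos (κ * C.d X)).le
  rwa [← mul_assoc, ← Real.exp_add, add_neg_cancel, Real.exp_zero, one_mul] at h1

/-- **ADMISSIBLE REAL FAMILIES OF FINITE SIZE LIE IN THE SLICE SPACE OF RECORD.** [folklore] -/
theorem embR_mem_sliceSub {κ : ℝ} {Adm : Set (Bg → C.Dom → ℝ)} {hsub : ∀ H₁ ∈ Adm, ∀ H₂ ∈ Adm, H₁ - H₂ ∈ Adm}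
    {hsmul : ∀ (c : ℝ), ∀ H ∈ Adm, c • H ∈ Adm} {hne : Adm.Nonempty} {H : Bg → C.Dom → ℝ} (hH : H ∈ Adm) {N : ℝ}
    (h : ∀ (U : Bg) (X : C.Dom), |H U X| ≤ Real.exp (-(κ * C.d X)) * N) : embR κ H ∈ sliceSub κ Adm hsub hsmul hne := by
  rw [mem_sliceSub, reF_embR h, imF_embR h]
  exact ⟨hH, zero_mem_of_closed hsub hH⟩

/-- **(B4) AT ACTUAL STATES**: the real part of the coordinate read-out of an embedded real family is its value:
`Re (coord κ U X (embR κ H)) = H U X`. [folklore] -/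
theorem coord_embR_re {κ : ℝ} {H : Bg → C.Dom → ℝ} {N : ℝ}
    (h : ∀ (U : Bg) (X : C.Dom), |H U X| ≤ Real.exp (-(κ * C.d X)) * N) (U : Bg) (X : C.Dom) :
    (coord κ U X (embR κ H)).re = H U X := by
  rw [coord_re_eq_reF, reF_embR h]

/-- [folklore] The embedding is compatible with differences of bounded families: `embR (H − H′) = embR H − embR H′`. -/
theorem embR_sub {κ : ℝ} {H H' : Bg → C.Dom → ℝ} {N N' : ℝ}
    (h : ∀ (U : Bg) (X : C.Dom), |H U X| ≤ Real.exp (-(κ * C.d X)) * N)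
    (h' : ∀ (U : Bg) (X : C.Dom), |H' U X| ≤ Real.exp (-(κ * C.d X)) * N') :
    embR κ (H - H') = embR κ H - embR κ H' := by
  have hd : ∀ (U : Bg) (X : C.Dom), |(H - H') U X| ≤ Real.exp (-(κ * C.d X)) * (N + N') := by
    intro U X
    rw [Pi.sub_apply, Pi.sub_apply, mul_add]
    exact (abs_sub _ _).trans (add_le_add (h U X) (h' U X))
  ext ⟨U, X⟩
  rw [lp.coeFn_sub, Pi.sub_apply, embR_apply_of_bound hd, embR_apply_of_bound h, embR_apply_of_bound h',
    Pi.sub_apply, Pi.sub_apply, ← Complex.ofReal_sub, ← mul_sub]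

/-- **THE STATE DISTANCE DOMINATES TERM DIFFERENCES** (the read-out inequality behind K2♭'s `hread`, ambient form): for two real
families of finite size, `|H U X − H′ U X| ≤ e^{−κd(X)}·‖embR κ H − embR κ H′‖`. [folklore] -/
theorem abs_sub_le_norm_embR_sub {κ : ℝ} {H H' : Bg → C.Dom → ℝ} {N N' : ℝ}
    (h : ∀ (U : Bg) (X : C.Dom), |H U X| ≤ Real.exp (-(κ * C.d X)) * N)
    (h' : ∀ (U : Bg) (X : C.Dom), |H' U X| ≤ Real.exp (-(κ * C.d X)) * N') (U : Bg) (X : C.Dom) :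
    |H U X - H' U X| ≤ Real.exp (-(κ * C.d X)) * ‖embR κ H - embR κ H'‖ := by
  have hd : ∀ (U : Bg) (X : C.Dom), |(H - H') U X| ≤ Real.exp (-(κ * C.d X)) * (N + N') := by
    intro U X
    rw [Pi.sub_apply, Pi.sub_apply, mul_add]
    exact (abs_sub _ _).trans (add_le_add (h U X) (h' U X))
  have h1 := abs_reF_le κ (embR κ (H - H')) U X
  rw [reF_embR hd, embR_sub h h'] at h1
  simpa only [Pi.sub_apply] using h1

end Summit.QuantumFields.BalabanUV.T4Continuum.NE9SliceSpaceOfRecord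

end
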